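import Summits.CriticalPhenomena.PercolationContinuityZ3.Theorems.Transplant.FKConnectivityAllQAntipodalX2SpineDefs
import HarnessLib

/-!
# Connectivity correlation inequalities for `φ_{w,q}` — file (DEFINITION): the TWO-SPINE word model of the split
# functional `U¹¹` at a split node `A ∘ B`, row MODES, moded coefficient arrays, diagram statements

Definitions file (`--supports stmt-CriticalPhenomena-4575`), FK sub-lane `prim-bschramm-fk-2` (gen 15); builds on p205010 (kernel
theorem, internal audit signed; external expert review pending).  No named facts, no sorries; standard axioms.  Pure combinatorics
on σ-words (`SLetter = Kind × Bool × Bool`, rows `sRowA`, `sRowB`, `headP`, `lastP`, `adjP` of the gen 12–14 files); nothing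
probabilistic and no graphs.

SETTING (memo `bschramm/FROM-fk-2-g15-TWO-SPINE.md` §1, §6).  At a split node `N = A ∘ B` (`∘` = series or parallel) of a two-terminal
series–parallel network with the marked edges `y ∈ A`, `z ∈ B`, a configuration of `A ∖ y` has a σ-word `u` along the spine of `y`
in `A` (innermost letter first, gen 14 `FK.spineWord`) and a configuration of `B ∖ z` a σ-word `v` along the spine of `z`.  The ROW
DATA of a row word `r : List Kind` (objects = walls `W` / particles `P`, innermost first) are: `c = lastP r` (terminals joined),
`c• = lastP r ∨ r = []` (joined once the marked edge is inserted), `K = headP r` (ends of the marked edge joined; `δ = 1 - K`),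
`corr = adjP false r` (adjacent particle pairs).  Gen 15's reduction: `q² · U¹¹(A·B)(h) = q^{c} · ∑_{(u,v)} Θ(u,v) · S(u,v)` with
`Θ(u,v) = q^{corr(u)+corr(v)} · (q^{-δ(α)-δ(β̄)}[c•(α)c(β) - c(ᾱ)c•(β̄)] + q^{-δ(ᾱ)-δ(β)}[c(α)c•(β) - c•(ᾱ)c(β̄)])`
(`α, ᾱ` = the two rows of `u`, `β, β̄` of `v`) and `S` the two-spine fibre sum of `h`.  The MODE INDUCTION (memo §6) evaluates each
row in a MODE `m ∈ {o, c, f, z, x}` — `o` = the row itself, `c` = "terminals wired" (connectivity `1`, `δ` of the wired row, cluster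
shift `+c`), `f` = connectivity forced `1`, `z` = forced `0`, `x` = forced `0` and wired — which is what peeling the outermost part of
a spine does to the inner rows (transition table `FK.TwoSpine.Mode.peel`).  This file defines:
* `FK.TwoSpine.Mode`, the moded row quantities `Mode.conn`, `Mode.connDot`, `Mode.del`, `Mode.shift`, the peeling table `Mode.peel`;
* `FK.TwoSpine.theta q top m u v` — the moded coefficient of the word pair `(u, v)` (series or parallel top), multiplied through by
  `q²` so that all exponents are natural numbers;
* `FK.TwoSpine.kindWords` (all σ-words of a shape), `FK.TwoSpine.UpFlip` (one `01 → 10` flip), `FK.TwoSpine.Admissible`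
  (nonnegative, flip-monotone, ordered families of test functions) and the DIAGRAM STATEMENT `FK.TwoSpine.DStmt`.
[cite: Grimmett2006, §1.4 eq. (1.20) (p. 15); §3.8 (pp. 61–62); §3.9 (p. 63)]
-/

noncomputable section

namespace Summit.CriticalPhenomena.PercolationContinuityZ3.Theorems

namespace FK

namespace TwoSpine

open X2Word

/-! ### Row data of a row word -/

/-- The row is connected between its terminals: its outermost object is a particle (`c = lastP`). [folklore] -/
def rowC (r : List Kind) : Bool := lastP r

/-- The row is connected once the marked edge is inserted: outermost object a particle, or no object at all. [folklore] -/
def rowCdot (r : List Kind) : Bool := lastP r || r.isEmpty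

/-- `δ` of a row: the two ends of the marked edge are NOT joined (the innermost object is not a particle), as `0/1`. [folklore] -/
def rowDel (r : List Kind) : ℕ := if headP r then 0 else 1

/-- `δ` of the WIRED row (terminals identified): `0` for the empty row (the straddle closes up), else `rowDel`. [folklore] -/
def rowDelW (r : List Kind) : ℕ := if r.isEmpty then 0 else rowDel r

/-- `corr` of a row: number of adjacent particle pairs. [folklore] -/
def rowCorr (r : List Kind) : ℕ := adjP false r

/-! ### Modes -/

/-- Row MODES of the mode induction (memo g15 §6): `o` open (the row itself), `c` closed/wired (connectivity `1`, wired `δ`,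
cluster shift `+c`), `f` forced connected (`1`, open `δ`), `z` forced disconnected (`0`, open `δ`), `x` forced `0` and wired. [folklore] -/
inductive Mode | o | c | f | z | x
  deriving DecidableEq, Repr, Inhabited

/-- Moded terminal connection of a row (marked edge absent), as a real `0/1`. [folklore] -/
def Mode.conn : Mode → List Kind → ℝ
  | .o, r => if rowC r then 1 else 0
  | .c, _ => 1
  | .f, _ => 1
  | .z, _ => 0
  | .x, _ => 0

/-- Moded terminal connection of a row with the marked edge inserted, as a real `0/1`. [folklore] -/
def Mode.connDot : Mode → List Kind → ℝ
  | .o, r => if rowCdot r then 1 else 0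
  | .c, _ => 1
  | .f, _ => 1
  | .z, _ => 0
  | .x, _ => 0

/-- Moded `δ` of a row (`∈ {0, 1}`): the wired modes `c, x` use the wired `δ`. [folklore] -/
def Mode.del : Mode → List Kind → ℕ
  | .o, r => rowDel r
  | .c, r => rowDelW r
  | .f, r => rowDel r
  | .z, r => rowDel r
  | .x, r => rowDelW r

/-- Moded cluster-count shift of a row: the wired modes `c, x` carry `+c` (one cluster saved when the wired row is itself connected). [folklore] -/
def Mode.shift : Mode → List Kind → ℕ
  | .c, r => if rowC r then 1 else 0
  | .x, r => if rowC r then 1 else 0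
  | _, _ => 0

/-- PEELING TABLE (memo g15 §6, verified on 9,945,000 instances): the mode of an inner row and the extra cluster shift when the
outermost part of the spine, of op kind `k` (`W` = series, `P` = parallel) and with row bit `b`, is peeled off a row in mode `m`.
Parallel: `o ↦ (b ? c : o)`, `c ↦ (c, +b)`, `f ↦ (b ? c : f)`, `z ↦ (b ? x : z)`, `x ↦ (x, +b)`; series: `o ↦ (b ? o : z)`,
`c ↦ (b ? c : f)`, `f ↦ f`, `z ↦ z`, `x ↦ (b ? x : z)`. [folklore] -/
def Mode.peel : Mode → Kind → Bool → Mode × ℕ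
  | .o, .P, b => (if b then .c else .o, 0)
  | .c, .P, b => (.c, if b then 1 else 0)
  | .f, .P, b => (if b then .c else .f, 0)
  | .z, .P, b => (if b then .x else .z, 0)
  | .x, .P, b => (.x, if b then 1 else 0)
  | .o, .W, b => (if b then .o else .z, 0)
  | .c, .W, b => (if b then .c else .f, 0)
  | .f, .W, _ => (.f, 0)
  | .z, .W, _ => (.z, 0)
  | .x, .W, b => (if b then .x else .z, 0)

/-! ### The moded coefficient of a word pair -/

/-- A 4-tuple of modes: rows `α, ᾱ` of the `A`-word and `β, β̄` of the `B`-word. [folklore] -/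
abbrev Modes := Mode × Mode × Mode × Mode

/-- Kind of the TOP node joining `A` and `B`: `W` = series, `P` = parallel. [folklore] -/
abbrev Top := Kind

/-- Total cluster-exponent offset of a word pair in modes `m`: `corr` of the four rows plus the mode shifts. [folklore] -/
def baseExp (m : Modes) (u v : List SLetter) : ℕ :=
  rowCorr (sRowA u) + rowCorr (sRowB u) + rowCorr (sRowA v) + rowCorr (sRowB v) +
    (m.1.shift (sRowA u) + m.2.1.shift (sRowB u) + m.2.2.1.shift (sRowA v) + m.2.2.2.shift (sRowB v))

/-- **The moded coefficient `Θ^m(u, v)` of the word pair `(u, v)`, multiplied by `q²`** (memo g15 §1, §6).  Series top: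
`q^{base} · (q^{2-δ(α)-δ(β̄)}[c•(α)c(β) - c(ᾱ)c•(β̄)] + q^{2-δ(ᾱ)-δ(β)}[c(α)c•(β) - c•(ᾱ)c(β̄)])` with every row quantity
read in its mode; parallel top: the two pairs `(γ, γᶜ)` read with `∨` and the parallel cluster corrections
`+c•(α)c(β) + c(ᾱ)c•(β̄)` resp. `+c(α)c•(β) + c•(ᾱ)c(β̄)` in the exponent. [cite: Grimmett2006, §3.8 (pp. 61–62)] -/
def theta (q : ℝ) (top : Top) (m : Modes) (u v : List SLetter) : ℝ :=
  let α := sRowA u; let ᾱ := sRowB u; let β := sRowA v; let β' := sRowB v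
  let a := m.1.conn α; let ad := m.1.connDot α; let ab := m.2.1.conn ᾱ; let abd := m.2.1.connDot ᾱ
  let b := m.2.2.1.conn β; let bd := m.2.2.1.connDot β; let bb := m.2.2.2.conn β'; let bbd := m.2.2.2.connDot β'
  let e₁ := 2 - m.1.del α - m.2.2.2.del β'
  let e₂ := 2 - m.2.1.del ᾱ - m.2.2.1.del β
  match top with
  | .W => q ^ baseExp m u v * (q ^ e₁ * (ad * b - ab * bbd) + q ^ e₂ * (a * bd - abd * bb))
  | .P => q ^ baseExp m u v *
      (q ^ e₁ * (q ^ (if ad * b = 1 then 1 else 0 : ℕ) * q ^ (if ab * bbd = 1 then 1 else 0 : ℕ)) *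
          ((ad + b - ad * b) - (ab + bbd - ab * bbd)) +
        q ^ e₂ * (q ^ (if a * bd = 1 then 1 else 0 : ℕ) * q ^ (if abd * bb = 1 then 1 else 0 : ℕ)) *
          ((a + bd - a * bd) - (abd + bb - abd * bb)))

/-! ### Words of a shape, flips, admissible families, diagram statements -/

/-- All σ-words of a SHAPE (list of op kinds, innermost first): the bits are free. [folklore] -/
def kindWords : List Kind → Finset (List SLetter)
  | [] => {[]}
  | k :: ks => ((Finset.univ : Finset (Bool × Bool)) ×ˢ kindWords ks).image fun c => (k, c.1.1, c.1.2) :: c.2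

/-- `UpFlip u u'`: the word `u'` arises from `u` by flipping ONE letter `01 → 10` (a loser part becomes a winner part). [folklore] -/
def UpFlip (u u' : List SLetter) : Prop :=
  ∃ (pre suf : List SLetter) (k : Kind), u = pre ++ (k, false, true) :: suf ∧ u' = pre ++ (k, true, false) :: suf

/-- A DIAGRAM: finitely many nodes, each a mode 4-tuple with a natural exponent offset, and order constraints `S_i ≤ S_j`. [folklore] -/
structure Diagram where
  /-- the nodes: modes of the four rows and the power of `q` carried by the node -/
  nodes : List (Modes × ℕ)
  /-- the order constraints `(i, j)`: the test function of node `i` is pointwise below that of node `j` -/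
  le : List (ℕ × ℕ)

/-- An ADMISSIBLE family of test functions for the diagram `D`: indexed by the nodes, nonnegative, FLIP-MONOTONE in each word
(a `01 → 10` flip of one letter does not decrease the value — at the level of configurations this is Theorem U for the flipped part,
gen 14 `FK.fiberSum_le_of_flip`) and ordered along `D.le`. [folklore] -/
structure Admissible (D : Diagram) (S : ℕ → List SLetter → List SLetter → ℝ) : Prop where
  nonneg : ∀ i u v, 0 ≤ S i u v
  monoA : ∀ i u u' v, UpFlip u u' → S i u v ≤ S i u' v
  monoB : ∀ i u v v', UpFlip v v' → S i u v ≤ S i u v'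
  le : ∀ p ∈ D.le, ∀ u v, S p.1 u v ≤ S p.2 u v

/-- The weighted sum of a diagram against a family over all word pairs of the shapes `oA, oB`:
`∑_i q^{e_i} ∑_{u ∈ words(oA)} ∑_{v ∈ words(oB)} Θ^{m_i}(u, v) · S_i(u, v)`. [folklore] -/
def dsum (q : ℝ) (top : Top) (D : Diagram) (oA oB : List Kind) (S : ℕ → List SLetter → List SLetter → ℝ) : ℝ :=
  ∑ i ∈ Finset.range D.nodes.length,
    q ^ (D.nodes.getD i ((.o, .o, .o, .o), 0)).2 *
      ∑ u ∈ kindWords oA, ∑ v ∈ kindWords oB, theta q top (D.nodes.getD i ((.o, .o, .o, .o), 0)).1 u v * S i u v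

/-- **The DIAGRAM STATEMENT `St(D)` for the shapes `(oA, oB)`**: the weighted sum of `D` is nonnegative against every admissible
family (memo g15 §6).  The statement of the single node `(o,o,o,o)` for the spine shapes of `y` in `A` and `z` in `B` is, after
gen 15's two-spine reduction, the nonnegativity of the split functional `U¹¹(A ∘ B)`. [folklore] -/
def DStmt (q : ℝ) (top : Top) (D : Diagram) (oA oB : List Kind) : Prop :=
  ∀ S : ℕ → List SLetter → List SLetter → ℝ, Admissible D S → 0 ≤ dsum q top D oA oB S

/-! ### Sanity instances -/

/-- The open mode reads the row's own connection. [folklore] -/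
@[simp] theorem Mode.conn_o (r : List Kind) : Mode.o.conn r = if rowC r then 1 else 0 := rfl
/-- The wired mode is connected. [folklore] -/
@[simp] theorem Mode.conn_c (r : List Kind) : Mode.c.conn r = 1 := rfl
/-- The forced-zero mode is disconnected. [folklore] -/
@[simp] theorem Mode.conn_z (r : List Kind) : Mode.z.conn r = 0 := rfl
/-- Peeling a connected parallel part wires an open row. [folklore] -/
example : Mode.o.peel .P true = (.c, 0) := rfl
/-- Peeling a disconnected series part un-wires a wired row. [folklore] -/
example : Mode.c.peel .W false = (.f, 0) := rfl
/-- The empty row: disconnected, connected once the marked edge is inserted, `δ = 1`, wired `δ = 0`. [folklore] -/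
example : rowC [] = false ∧ rowCdot [] = true ∧ rowDel [] = 1 ∧ rowDelW [] = 0 := by decide
/-- There are `4^K` words of a shape of length `K`; e.g. one parallel position. [folklore] -/
example : (kindWords [.P]).card = 4 := by decide

end TwoSpine

end FK

end Summit.CriticalPhenomena.PercolationContinuityZ3.Theorems

end
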